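import Mathlib
import Summits.ResolutionOfSingularities.ResolutionOfSingularities.Theorems.RadicialJungCleanModelsLens5TFrameIR
import HarnessLib

/-!
# Route `RadicialJung`, crux `CleanModels` (stmt-15917): T⁗ port part 3/13 — §D PORT 1⁗ `finrank_adjoin_frame_eq_card`, `port_gradedDataFrame` (source :864–1089)

PORT (line lead `res-B-lead-1` g8, for Sketch rev 32) of res-B-lens-5's crux workfiles `Cruxes/DescentPerfectToAll/Lens5_TFrame.lean` rev 4
(crux ae884a356928; author res-B-lens-5 g15; `lean check` rc 0 · 0 sorries · 0 warnings; crit-1 TRIAGE-146/150 PASS) and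
`Cruxes/DescentPerfectToAll/Lens5_PDegreeCount.lean` rev 3 (crux 100289d6413b; TRIAGE-151 PASS): THEOREMS T⁗ / T⁗′ / T⁗″ / T⁗‴ — the slice
{`[Γ:pΓ] = p²`, `k` of FINITE `p`-rank `r`, `[κ_v : κ_v^p] = p^r`} of the research stub `stub_cleanLU3DefectNonDiscrete` (valuations of MINIMAL
Frobenius defect `d(K|K^p, v) = p`, ANY such ground field: no perfectness, no separability of `K/k` or `κ_v/k`), modulo F-02 `CossartPiltant2019` and
F-32 (`hEmb`) only.  The port is split into def-free modules `…Lens5TFrame{RG,IR,Graded,Port2,Port4Core,Layer,Layer2,Port4,Composition,PMon,PDegreeA,PDegreeB,PDegreeC}`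
over ONE currency module `…Lens5TFrameCurrency` (the authors' `def`s, verbatim); declarations VERBATIM, namespace
`Summit.ResolutionOfSingularities.ResolutionOfSingularities.Theorems.RadicialJungCleanModels.Lens5TFrame` (the authors' §A copy of
`Lens5_PDegreeSep` and the constant-frame corollaries `cleanLU3DefectPRankTwoSepFin_of_frame` / `…SepFin_of_cossartPiltant2019'` are not ported).
OURS · counted 0 · nothing here proves resolution in characteristic `p`.


-/

set_option linter.dupNamespace false -- mandated namespace of this single-conjunct summit

section

open IsLocalRing
open Literature.AlgebraicGeometry.Resolution
open Summit.ResolutionOfSingularities.ResolutionOfSingularities.Theorems.RadicialJung.CleanModels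
open Summit.ResolutionOfSingularities.ResolutionOfSingularities.Theorems.RadicialJung.CleanModels.Lens5
open Summit.ResolutionOfSingularities.ResolutionOfSingularities.Theorems.RadicialJung.CleanModels.Lens5.PRankTwoCurrency
open Summit.ResolutionOfSingularities.ResolutionOfSingularities.Theorems.RadicialJung.CleanModels.Lens5.PRankTwoAssembly
open Summit.ResolutionOfSingularities.ResolutionOfSingularities.Theorems.RadicialJungCleanModels.Lens5RegularityCriterion
open Summit.ResolutionOfSingularities.ResolutionOfSingularities.Theorems.RadicialJungCleanModels.Lens5ChartSurjection

namespace Summit.ResolutionOfSingularities.ResolutionOfSingularities.Theorems.RadicialJungCleanModels.Lens5TFrame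

/-- **`[K^p(W) : K^p] = |S|` for a multiplicative frame which is `K^p`-linearly independent.**  `K^p(W) =` the `K^p`-span of `W`
(products `W_s W_t = Σ_u d_u^p W_u` and `1 = Σ_u d_u^p W_u` stay in the span). [folklore] -/
theorem finrank_adjoin_frame_eq_card {p : ℕ} [Fact p.Prime] {K : Type} [Field K] [CharP K p]
    {S : Type} [Fintype S] (W : S → K)
    (hWmul : ∀ s t : S, ∃ d : S → K, W s * W t = ∑ u, d u ^ p * W u)
    (hW1 : ∃ d : S → K, ∑ u, d u ^ p * W u = 1)
    (hli : LinearIndependent (frobenius K p).fieldRange W) :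
    Module.finrank (frobenius K p).fieldRange
        (IntermediateField.adjoin (frobenius K p).fieldRange (Set.range W)) = Fintype.card S := by
  classical
  have hp : p.Prime := Fact.out
  set Kp : Subfield K := (frobenius K p).fieldRange with hKpdef
  have hpowKp : ∀ x : K, x ^ p ∈ Kp := fun x => RingHom.mem_fieldRange.mpr ⟨x, frobenius_def p x⟩
  -- every `W s` is algebraic over `K^p` (root of `X^p - W_s^p`)
  have halg : ∀ x ∈ Set.range W, IsAlgebraic Kp x := by
    rintro x ⟨s, rfl⟩
    refine IsIntegral.isAlgebraic ⟨Polynomial.X ^ p - Polynomial.C (⟨W s ^ p, hpowKp (W s)⟩ : Kp),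
      Polynomial.monic_X_pow_sub_C _ hp.ne_zero, ?_⟩
    simp [Polynomial.eval₂_sub, Polynomial.eval₂_X_pow]
    exact sub_self (W s ^ p)
  set E := IntermediateField.adjoin Kp (Set.range W) with hEdef
  have hEalg : E.toSubalgebra = Algebra.adjoin Kp (Set.range W) :=
    IntermediateField.adjoin_toSubalgebra_of_isAlgebraic halg
  -- the `K^p`-span of `W` is closed under multiplication and contains `1`
  set V : Submodule Kp K := Submodule.span Kp (Set.range W) with hVdef
  have hWV : ∀ s, W s ∈ V := fun s => Submodule.subset_span ⟨s, rfl⟩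
  have hsumV : ∀ d : S → K, ∑ u, d u ^ p * W u ∈ V := by
    intro d
    refine sum_mem fun u _ => ?_
    have : d u ^ p * W u = (⟨d u ^ p, hpowKp _⟩ : Kp) • W u := by
      rw [Subfield.smul_def, smul_eq_mul]
    rw [this]
    exact V.smul_mem _ (hWV u)
  have hWmulV : ∀ s, ∀ y ∈ V, W s * y ∈ V := by
    intro s y hy
    induction hy using Submodule.span_induction with
    | mem x hx =>
      obtain ⟨t, rfl⟩ := hx
      obtain ⟨d, hd⟩ := hWmul s t
      rw [hd]; exact hsumV d
    | zero => rw [mul_zero]; exact V.zero_mem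
    | add x y _ _ hx hy => rw [mul_add]; exact V.add_mem hx hy
    | smul a x _ hx => rw [mul_smul_comm]; exact V.smul_mem a hx
  have hmulV : ∀ x ∈ V, ∀ y ∈ V, x * y ∈ V := by
    intro x hx y hy
    induction hx using Submodule.span_induction with
    | mem x hx' => obtain ⟨s, rfl⟩ := hx'; exact hWmulV s y hy
    | zero => rw [zero_mul]; exact V.zero_mem
    | add x₁ x₂ _ _ h₁ h₂ => rw [add_mul]; exact V.add_mem h₁ h₂
    | smul a x _ hx => rw [smul_mul_assoc]; exact V.smul_mem a hx
  have h1V : (1 : K) ∈ V := by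
    obtain ⟨d, hd⟩ := hW1
    rw [← hd]; exact hsumV d
  have hclosure : (Submonoid.closure (Set.range W) : Set K) ⊆ V := by
    intro x hx
    induction hx using Submonoid.closure_induction with
    | mem x hx => exact Submodule.subset_span hx
    | one => exact h1V
    | mul x y _ _ hx hy => exact hmulV x hx y hy
  have hspan : Subalgebra.toSubmodule (Algebra.adjoin Kp (Set.range W)) = V := by
    rw [Algebra.adjoin_eq_span]
    apply le_antisymm
    · exact Submodule.span_le.mpr hclosure
    · exact Submodule.span_mono Submonoid.subset_closure
  have hV : Module.finrank Kp V = Fintype.card S := finrank_span_eq_card hli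
  calc Module.finrank Kp E = Module.finrank Kp E.toSubalgebra := (IntermediateField.finrank_eq_finrank_subalgebra _).symm
    _ = Module.finrank Kp (Subalgebra.toSubmodule E.toSubalgebra) := (Subalgebra.finrank_toSubmodule _).symm
    _ = Module.finrank Kp V := by rw [hEalg, hspan]
    _ = Fintype.card S := hV

/-- **PORT 1⁗ (graded data in a VALUATION `p`-FRAME — no ground-field separability).**  `M := K^p(g₀)` with its `p`-th-power
values and RG for the frame `W`; `x, y ∈ 𝔪_v` with (P2); and the DOUBLE grading: every `a ∈ K` is `Σ_{s,(a,b)} m_{s,ab} W_s x^a y^b`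
with `m ∈ M`, UNIQUELY (`{W_s x^a y^b}` is an `M`-basis of `K`: `[K : K^p(W)] = p³` (hdeg), `[K^p(W) : K^p] = |S|` (RG + the
multiplication table of the frame), `[K^p(g₀) : K^p] = p`), and every piece of an element of `O` lies in `O` (DG).  PROVED
(= PORT 1′ of `Lens5_TPrime.lean` with the constant family `b ⊆ k` replaced by an arbitrary frame `W ⊆ O_v`; ingredients
✓ ImmediateValues*, ✓ GradedBasis, §C RG + IR). [folklore] -/
theorem port_gradedDataFrame (p : ℕ) [Fact p.Prime]
    {K : Type} [Field K] [CharP K p] (O : ValuationSubring K)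
    (g₀ : K) (hg₀ : ∀ c : K, c ^ p ≠ g₀)
    (hdefect : ∀ f₀ : K, ∃ f₁ : K, O.valuation (g₀ - f₁ ^ p) < O.valuation (g₀ - f₀ ^ p))
    (hP2 : PRankTwoAt p O)
    {S : Type} [Fintype S] (W : S → K) (hPI : ResiduallyPIndependentFamily p O W)
    (hWmul : ∀ s t : S, ∃ d : S → K, W s * W t = ∑ u, d u ^ p * W u)
    (hW1 : ∃ d : S → K, ∑ u, d u ^ p * W u = 1)
    (hdeg : Module.finrank (Subfield.closure (Set.range W ∪ Set.range (fun x : K => x ^ p))) K = p ^ 3) :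
    ∃ (M : Subfield K), (∀ x : K, x ∈ M ↔ ∃ c : Fin p → K, ∑ j, c j ^ p * g₀ ^ (j : ℕ) = x) ∧ g₀ ∈ M ∧
      (∀ x : K, x ^ p ∈ M) ∧ (∀ m : K, m ∈ M → m ≠ 0 → ∃ w : K, w ≠ 0 ∧ O.valuation m = O.valuation (w ^ p)) ∧
      (∀ c : S → K, (∀ i, c i ∈ M) →
        O.valuation (∑ i : S, c i * W i) = Finset.univ.sup (fun i => O.valuation (c i))) ∧
      ∃ (x y : K), x ≠ 0 ∧ y ≠ 0 ∧ O.valuation x < 1 ∧ O.valuation y < 1 ∧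
        (∀ a b : ℕ, a < p → b < p → (a ≠ 0 ∨ b ≠ 0) → ∀ z : K, z ≠ 0 →
          O.valuation (x ^ a * y ^ b) ≠ O.valuation (z ^ p)) ∧
        (∀ f : S × (Fin p × Fin p) → K, (∀ l, f l ∈ M) →
          ∑ l, f l * (W l.1 * (x ^ (l.2.1 : ℕ) * y ^ (l.2.2 : ℕ))) = 0 → ∀ l, f l = 0) ∧
        ∃ (cf : K → S × (Fin p × Fin p) → K), (∀ a l, cf a l ∈ M) ∧
          (∀ a, ∑ l : S × (Fin p × Fin p), cf a l * (W l.1 * (x ^ (l.2.1 : ℕ) * y ^ (l.2.2 : ℕ))) = a) ∧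
          (∀ a, a ∈ O → ∀ l : S × (Fin p × Fin p), cf a l * (W l.1 * (x ^ (l.2.1 : ℕ) * y ^ (l.2.2 : ℕ))) ∈ O) := by
  classical
  have hp : p.Prime := Fact.out
  haveI : NeZero p := ⟨hp.ne_zero⟩
  -- ## `M = K^p(g₀)` with its `p`-th-power values (✓ ImmediateValues), IR (§C) and RG (§C)
  obtain ⟨M, hM, hg₀M, hpM, hV⟩ := ImmediateValues.exists_subfield_immediate_values (p := p) O.valuation g₀ hdefect
  have hIR : ∀ m : K, m ∈ M → O.valuation m = 1 → ∃ w : K, O.valuation (m - w ^ p) < 1 :=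
    fun m hm hvm => immediateResidues_of_noBestApprox O g₀ hdefect M hM m hm hvm
  have hRG : ∀ c : S → K, (∀ i, c i ∈ M) →
      O.valuation (∑ i : S, c i * W i) = Finset.univ.sup (fun i => O.valuation (c i)) :=
    fun c hc => valuation_sum_mul_family_eq_sup O M hIR W hPI c hc
  have hB1 : ∀ s, O.valuation (W s) = 1 := valuation_eq_one_of_residuallyPIndependentFamily O W hPI
  have hB0 : ∀ s, W s ≠ 0 := fun s h => by have := hB1 s; rw [h, map_zero] at this; exact zero_ne_one this
  -- ## `S` is non-empty (`1 = Σ_s d_s^p W_s`)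
  haveI : Nonempty S := by
    by_contra hS
    obtain ⟨d, hd⟩ := hW1
    have : (1 : K) = 0 := by rw [← hd]; exact Finset.sum_eq_zero fun s _ => (hS ⟨s⟩).elim
    exact one_ne_zero this
  -- ## `W` is `K^p`-linearly independent (by RG over `M ⊇ K^p`)
  set Kp : Subfield K := (frobenius K p).fieldRange with hKpdef
  have hKpM : ∀ z : K, z ∈ Kp → z ∈ M := by
    intro z hz
    obtain ⟨u, rfl⟩ := RingHom.mem_fieldRange.mp hz
    rw [frobenius_def]; exact hpM u
  have hBli : LinearIndependent Kp W := by
    rw [Fintype.linearIndependent_iff]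
    intro g hg i
    have hsum : ∑ i, (g i : K) * W i = 0 := by
      have : ∑ i, (g i : K) * W i = ∑ i, g i • W i :=
        Finset.sum_congr rfl fun i _ => (Subfield.smul_def (g i) _).symm
      rw [this, hg]
    have hv := hRG (fun i => (g i : K)) (fun i => hKpM _ (g i).2)
    rw [hsum, map_zero] at hv
    have hle : O.valuation (g i : K) ≤ Finset.univ.sup (fun i => O.valuation (g i : K)) :=
      Finset.le_sup (f := fun i => O.valuation (g i : K)) (Finset.mem_univ i)
    rw [← hv, le_zero_iff, map_eq_zero] at hle
    exact_mod_cast hle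
  -- ## degrees: `[K : K^p] = |S|·p³` (from (hdeg) `[K : K^p(W)] = p³` and `[K^p(W) : K^p] = |S|`), `[K : M] = |S|·p²`
  have hF₀ : (IntermediateField.adjoin Kp (Set.range W)).toSubfield =
      Subfield.closure (Set.range W ∪ Set.range (fun x : K => x ^ p)) := by
    rw [IntermediateField.adjoin_toSubfield]
    have hrange : Set.range (algebraMap Kp K) = Set.range (fun x : K => x ^ p) := by
      ext z
      constructor
      · rintro ⟨w, rfl⟩
        obtain ⟨u, hu⟩ := RingHom.mem_fieldRange.mp w.2
        refine ⟨u, ?_⟩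
        show u ^ p = (w : K)
        rw [← hu, frobenius_def]
      · rintro ⟨u, rfl⟩
        refine ⟨⟨u ^ p, RingHom.mem_fieldRange.mpr ⟨u, frobenius_def ..⟩⟩, ?_⟩
        rfl
    rw [hrange, Set.union_comm]
  have hdegF₀ : Module.finrank (IntermediateField.adjoin Kp (Set.range W)) K = p ^ 3 := by
    have h : Module.finrank (IntermediateField.adjoin Kp (Set.range W)).toSubfield K = p ^ 3 := by
      rw [hF₀]; exact hdeg
    exact h
  have hF₀deg : Module.finrank Kp (IntermediateField.adjoin Kp (Set.range W)) = Fintype.card S :=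
    finrank_adjoin_frame_eq_card W hWmul hW1 hBli
  have hKp : Module.finrank Kp K = Fintype.card S * p ^ 3 := by
    have htower := Module.finrank_mul_finrank Kp (IntermediateField.adjoin Kp (Set.range W)) K
    rw [hF₀deg, hdegF₀] at htower
    exact htower.symm
  have hMdeg : Module.finrank Kp (IntermediateField.adjoin Kp ({g₀} : Set K)) = p :=
    ImmediateValues.finrank_adjoin_pthPowers_eq g₀ hg₀
  have hfinM' : Module.finrank (IntermediateField.adjoin Kp ({g₀} : Set K)) K = Fintype.card S * p ^ 2 := by
    have htower := Module.finrank_mul_finrank Kp (IntermediateField.adjoin Kp ({g₀} : Set K)) K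
    rw [hMdeg, hKp] at htower
    have h' : p * Module.finrank (IntermediateField.adjoin Kp ({g₀} : Set K)) K = p * (Fintype.card S * p ^ 2) := by
      rw [htower]; ring
    exact Nat.eq_of_mul_eq_mul_left hp.pos h'
  have hMM : (IntermediateField.adjoin Kp ({g₀} : Set K)).toSubfield = M :=
    Subfield.ext fun z => (ImmediateValues.mem_adjoin_pthPowers_iff g₀ z).trans (hM z).symm
  have hfin : Module.finrank M K = Fintype.card S * p ^ 2 := by
    have h : Module.finrank (IntermediateField.adjoin Kp ({g₀} : Set K)).toSubfield K = Fintype.card S * p ^ 2 := hfinM'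
    rw [hMM] at h
    exact h
  -- ## (P2), normalised into the maximal ideal of `O` (as in Port 1)
  obtain ⟨x₀, y₀, hx₀, hy₀, hP₀⟩ := hP2
  obtain ⟨x, hx, hvx, hPx⟩ := exists_pRankTwo_lt_one_left hp O hx₀ hP₀
  obtain ⟨y, hy, hvy, hPy⟩ := exists_pRankTwo_lt_one_left hp O hy₀ (pRankTwo_swap O hPx)
  have hP := pRankTwo_swap O hPy
  -- ## the doubly graded representation
  have hDG := fun (m : S × (Fin p × Fin p) → K) (hm : ∀ l, m l ∈ M) =>
    valuation_term_le_double_sum hp O M hV W hB1 hRG hx hy hP m hm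
  set e : S × (Fin p × Fin p) → K :=
    fun l => W l.1 * (x ^ (l.2.1 : ℕ) * y ^ (l.2.2 : ℕ)) with he
  have he0 : ∀ l, e l ≠ 0 := fun l =>
    mul_ne_zero (hB0 _) (mul_ne_zero (pow_ne_zero _ hx) (pow_ne_zero _ hy))
  have hli : LinearIndependent M e := by
    rw [Fintype.linearIndependent_iff]
    intro g hg l
    have hsum : ∑ l, (g l : K) * e l = 0 := by
      have : ∑ l, (g l : K) * e l = ∑ l, g l • e l :=
        Finset.sum_congr rfl fun l _ => (Subfield.smul_def (g l) (e l)).symm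
      rw [this, hg]
    have hle := hDG (fun l => (g l : K)) (fun l => (g l).2) l
    simp only [he] at hsum
    rw [hsum, map_zero, le_zero_iff, map_eq_zero] at hle
    rcases mul_eq_zero.mp hle with h1 | h1
    · exact_mod_cast h1
    · exact absurd h1 (he0 l)
  have hLI : ∀ f : S × (Fin p × Fin p) → K, (∀ l, f l ∈ M) →
      ∑ l, f l * (W l.1 * (x ^ (l.2.1 : ℕ) * y ^ (l.2.2 : ℕ))) = 0 → ∀ l, f l = 0 := by
    intro f hf hsum l
    have h := Fintype.linearIndependent_iff.mp hli (fun l => (⟨f l, hf l⟩ : M)) ?_ l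
    · simpa using congrArg Subtype.val h
    · have : ∑ l, (⟨f l, hf l⟩ : M) • e l = ∑ l, f l * (W l.1 * (x ^ (l.2.1 : ℕ) * y ^ (l.2.2 : ℕ))) :=
        Finset.sum_congr rfl fun l _ => by rw [Subfield.smul_def, smul_eq_mul, he]
      rw [this, hsum]
  have hcard : Fintype.card (S × (Fin p × Fin p)) = Fintype.card S * p ^ 2 := by
    simp [Fintype.card_prod, Fintype.card_fin]; ring
  have hNpos : 0 < Fintype.card S * p ^ 2 := Nat.mul_pos Fintype.card_pos (pow_pos hp.pos 2)
  have hrepr : ∀ a : K, ∃ c : S × (Fin p × Fin p) → M, ∑ l, (c l : K) * e l = a := by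
    intro a
    obtain ⟨c, hc⟩ := ImmediateValues.exists_repr_of_linearIndependent_card_eq M hfin hNpos _ hli hcard a
    refine ⟨c, ?_⟩
    simpa only [Subfield.smul_def, smul_eq_mul] using hc
  choose c hc using hrepr
  refine ⟨M, hM, hg₀M, hpM, hV, hRG, x, y, hx, hy, hvx, hvy, hP, hLI, fun a l => (c a l : K),
    fun a l => (c a l).2, fun a => hc a, ?_⟩
  intro a haO l
  have hva : O.valuation a ≤ 1 := (O.valuation_le_one_iff a).mpr haO
  have hterm := hDG (fun l => (c a l : K)) (fun l => (c a l).2) l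
  simp only [he] at hc
  rw [hc a] at hterm
  exact (O.valuation_le_one_iff _).mp (hterm.trans hva)

end Summit.ResolutionOfSingularities.ResolutionOfSingularities.Theorems.RadicialJungCleanModels.Lens5TFrame

end
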